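import Summits.BirchSwinnertonDyer.BirchSwinnertonDyer.Theorems.AdditiveKolyvaginRoadLowerHalfDescentQuadratic
import Summits.BirchSwinnertonDyer.BirchSwinnertonDyer.Theorems.EdixhovenFibreFiveSevenTwistDegreeStepFiveSevenAddvUnitTwist
import Summits.BirchSwinnertonDyer.Rank1Residual.Additive.X4RankZeroKatoBound
import Summits.BirchSwinnertonDyer.Rank1Residual.Additive.QuadraticTwistSurj
import Summits.BirchSwinnertonDyer.Rank1Residual.AdditivePotMult.TwistSupplyJ
import Literature.NumberTheory.EllipticCurves.Kato2004.Condition1252SemistableProofs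
import Literature.NumberTheory.EllipticCurves.NonEisensteinPrimeOfSurjective
import HarnessLib

/-!
# Route `AdditiveKolyvaginRoad`: the partner's UPPER half at an additive POTENTIALLY GOOD `p ≥ 5` from KATO 2004 Thm. 14.5 (3), and the
# half-descent «LOWER over an auxiliary quadratic field + Kato for the partner twist ⟹ `Typed.MissingLowerBoundAt` over `ℚ`» with the
# partner's binders DISCHARGED from a ♯ frame when `p` is unramified in the auxiliary field
# (crux KS′ `LevelKolyvaginSystemsAdditive`, item stmt-BirchSwinnertonDyer-21396; card `inert-theta-refinement` — real quadratic `F`, `p` INERT;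
# also card `parahoric-ordinary-type-engine`; cell `pub/bsd-wall`, width seat `bsd-wall-akr-p2x-w3` g11; `--supports` 21396, helper)

THEOREMS ONLY (no definition, no named fact, no `sorry`).  CONDITIONAL on the displayed named facts — Kato 2004 Thm. 14.5 (3) with
Prop. 14.16 (2) at an additive potentially good `p ≠ 2` (`Kato2004.rankZero_padicValNat_sha_le_of_additive_potGood_of_imageContainsSL2`),
Gross–Zagier–Kolyvagin (`rank_eq_analyticRank_of_analyticRank_le_one`), modularity (`hasEntireLFunction_rat`), Dokchitser–Dokchitser 2010
Thm. 2.3 in Milne's form (`Milne1972.bsdQuotientP_baseChange_relQuadratic_anyModel`) — and on the displayed LOWER half over the auxiliary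
field (an engine's output, research).  BSD is not proved by any of this; KS′ and KPA′ stay OPEN at `p² ∣ N`.

THE POINT.  The newest crux-ideation card `Cruxes/LevelKolyvaginSystemsAdditive/Ideas/inert-theta-refinement.md` proposes to prove the
LOWER (Eisenstein) half of `BSD_p` for `E` over a REAL quadratic field `F` in which the additive potentially supersingular prime `p ≥ 5`
is INERT (there `V_pE|G_{ℚ_{p²}}` is trianguline) and to HALF-DESCEND to `ℚ` with the Euler-system half of the partner twist
`E^{(d_F)}`.  Its sketch's half-descent (`InertThetaRefinementSketch.missingLowerBoundAt_of_lowerHalfOver_of_upper_twist`) is ALREADY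
the tree's `QuadraticDescent.missingLowerBoundAt_of_lowerBaseChange_of_missingUpperBoundAt_twist` (width seat akr-p2x-w4, any quadratic
field, `Ш[p^∞]` currency, no finiteness of `Ш(E_F)` needed) — cited here, not restated.  What this file adds is the partner's half from
KATO rather than Kim–Nakamura (sibling file `…LowerHalfDescentOfKimNakamura.lean` needs `p > 7 ∨` non-exceptional and the `(ℓ ∓ 1)`
binders, which are NOT hypotheses of a ♯ frame of the crux): at an additive POTENTIALLY GOOD `p ≥ 5` Kato's (12.5.2) is AUTOMATIC from
`ρ̄_{E,p}` onto (Serre, `Kato2004.imageContainsSL2_of_surj_of_five_le_or_semistable`), surjectivity passes to every twist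
(`Additive.surj_iff_of_model_twist`), potential good reduction is a property of `j` (`AdditivePotMult.j_of_model_twist`), and additivity
at `p` passes to a twist by a `p`-adic UNIT (`AddvUnitTwist.addv_of_model_unit_twist`) — the card's «`p` inert in `F`» is `ord_p d_F = 0`.

* §1 `missingUpperBoundAt_of_kato_of_surj_of_five_le` — `Typed.MissingUpperBoundAt W p` for `W/ℚ` globally minimal of analytic rank `0`,
  `p ≥ 5` additive potentially good (`Addv W p`, `0 ≤ ord_p j`), `ρ̄_{W,p}` onto, `p ∤ ∏ c_ℓ`, a parametrisation datum with `p ∤ c_D`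
  (the frame-shaped reading of `X4RankZero.missingUpperBoundAt_of_kato`: tower surjectivity from `surj(p)` at `p ≥ 5`).
* §2 `missingLowerBoundAt_of_lowerBaseChange_of_kato_twist` — `W/ℚ` of analytic rank `≤ 1`, `K = ℚ(θ₁)` ANY quadratic field (`θ₁² = c`),
  `Wc` a globally minimal model of `W^{(c)}` which is additive potentially good at `p ≥ 5`, of analytic rank `0`, with `ρ̄_{Wc,p}` onto,
  `p ∤ ∏ c_ℓ(Wc)` and a datum `Dc` with `p ∤ c_{Dc}`; `VK` any `K`-model of `W_K`; the LOWER half of `BSD_p` for `VK` over `K`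
  ⟹ `Typed.MissingLowerBoundAt W p`.
* §3 `missingLowerBoundAt_of_lowerBaseChange_unitTwist_of_kato` — the ♯-FRAME form: `W` itself additive potentially good at `p ≥ 5` with
  `ρ̄_{W,p}` onto and `ord_p c = 0` (`p` UNRAMIFIED in `K` — the card's inert `p`, or a split `p`); then the partner's image,
  potential-good and additivity binders are DISCHARGED, leaving `r_an(Wc) = 0`, `p ∤ ∏ c_ℓ(Wc)`, the datum, and the LOWER half over `K`.
  This is the hypothesis `hlow` of the landing socket `AdditiveKoly.exists_kolyvaginClass_ne_zero_of_lowerHalves` (p638284) at the frame,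
  and — applied to a minimal model of `E^{(d_K)}` — its `hlowTw`; the per-frame composition is the sibling file
  `…KolyvaginClassOfQuadraticLowerHalves.lean`.

References: K. Kato, Astérisque 295 (2004) Thm. 14.5 (3), Prop. 14.16 (2), (12.5.2); J.-P. Serre, *Abelian ℓ-adic representations*
IV-23 Lemma 3; T. Dokchitser, V. Dokchitser, Ann. of Math. 172 (2010) Thm. 2.3; R. L. Miller, LMS JCM 14 (2011) Def. 1.1;
J. H. Silverman, *AEC* VII.5.1, X.5.4.
-/

-- D-0017: single-problem summit, so `Summit.BirchSwinnertonDyer.BirchSwinnertonDyer.…` repeats a namespace BY DESIGN.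
set_option linter.dupNamespace false
set_option autoImplicit false

noncomputable section

open scoped NumberField Classical

open NumberField WeierstrassCurve
  Literature.NumberTheory.EllipticCurves Literature.NumberTheory.EllipticCurves.ModularForms
  Literature.NumberTheory.EllipticCurves.Rank1Residual Literature.NumberTheory.EllipticCurves.Rank1Residual.Typed
  Summit.BirchSwinnertonDyer.Rank1Residual Summit.BirchSwinnertonDyer.Rank1Residual.Additive
  Summit.BirchSwinnertonDyer.BirchSwinnertonDyer.Theorems

namespace Summit.BirchSwinnertonDyer.BirchSwinnertonDyer.Theorems.AdditiveKoly.QuadraticDescent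

/-! ## §1 The UPPER half at an additive potentially good `p ≥ 5` in analytic rank `0`, from Kato and `surj(p)` -/

/-- **`Typed.MissingUpperBoundAt W p` (`ord_p #Ш(E) ≤ ord_p #Ш(E)_an`) in analytic rank `0` at an ADDITIVE POTENTIALLY GOOD `p ≥ 5` with
`ρ̄_{E,p}` onto, from Kato 2004 Thm. 14.5 (3) + Prop. 14.16 (2) (named fact `hKato`), Gross–Zagier–Kolyvagin (`hGZK`) and modularity
(`hmod`).**  Binders: `W` globally minimal, `5 ≤ p`, `Addv W p` (neither good nor multiplicative), `0 ≤ ord_p j(W)` (potentially good),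
`W.HasSurjectiveModNGaloisRep p`, `p ∤ ∏ c_ℓ`, `r_an(W) = 0`, a parametrisation datum `D` with `p ∤ c_D` (vestigial in Kato's
normalisation, carried as in the fact).  Proof: Kato's (12.5.2) `ImageContainsSL2 W p` — equivalently tower surjectivity
`∀ n, surj(p^n)` — follows from `surj(p)` at `p ≥ 5` (Serre IV-23, `WeierstrassCurve.forall_hasSurjectiveModNGaloisRep_pow_of_surj_of_five_le_or_semistable`),
`E[p]` is irreducible, and `X4RankZero.missingUpperBoundAt_of_kato` applies.
[cite: Kato2004Asterisque, Thm. 14.5 (3) (p. 236), Prop. 14.16 (2) (p. 244), (12.5.2) (p. 222)]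
[cite: SerreAbelianLadic1968, Ch. IV §3.4, Lemma 3 (IV-23)] [cite: Miller2011LMS, Def. 1.1 (arXiv:1010.2431 p. 3)] -/
theorem missingUpperBoundAt_of_kato_of_surj_of_five_le (W : WeierstrassCurve ℚ) [W.IsElliptic] [W.IsGloballyMinimal]
    (p : ℕ) [hp : Fact p.Prime]
    (hKato : Kato2004.rankZero_padicValNat_sha_le_of_additive_potGood_of_imageContainsSL2)
    (hGZK : rank_eq_analyticRank_of_analyticRank_le_one) (hmod : hasEntireLFunction_rat)
    (hp5 : 5 ≤ p) (hadd : Addv W p) (hpot : 0 ≤ padicValRat p W.j) (hsurj : W.HasSurjectiveModNGaloisRep p)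
    (htam : ¬ p ∣ W.tamagawaProduct) (hr : W.analyticRank = 0)
    {N : ℕ} [NeZero N] (D : ModularParametrizationData W N) (hc : ¬ (p : ℤ) ∣ D.maninConstant) :
    MissingUpperBoundAt W p := by
  have hp2 : p ≠ 2 := by omega
  have hirr : W.HasIrreducibleModPGaloisRep p := hasIrreducibleModPGaloisRep_of_hasSurjectiveModNGaloisRep W p hsurj
  have htower : ∀ n : ℕ, W.HasSurjectiveModNGaloisRep (p ^ n : ℕ) :=
    W.forall_hasSurjectiveModNGaloisRep_pow_of_surj_of_five_le_or_semistable p hp2 (Or.inl hp5) hsurj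
  exact X4RankZero.missingUpperBoundAt_of_kato W p hKato hGZK hmod hr ⟨hp2, hadd, hirr⟩ hpot htower htam D hc

/-! ## §2 LOWER over an auxiliary quadratic field + Kato for the partner twist ⟹ LOWER over `ℚ` -/

/-- **The Eisenstein half of `BSD(E,p)` over `ℚ` from an AUXILIARY quadratic field, the partner's Euler-system half supplied by KATO.**  For
`W/ℚ` globally minimal of analytic rank `≤ 1` (so `Ш(E)` is finite by `hGZK`), a quadratic field `K = ℚ(θ₁)` (`θ₁² = c`, `θ₁ ∉ ℚ`;
real or imaginary — for the card `inert-theta-refinement` `K = F` is REAL with `p` INERT), a globally minimal model `Wc` of `W^{(c)}` which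
is ADDITIVE and POTENTIALLY GOOD at `p ≥ 5` (`Addv Wc p`, `0 ≤ ord_p j(Wc)`), of analytic rank `0`, with `ρ̄_{Wc,p}` onto, `p ∤ ∏ c_ℓ(Wc)`
and a parametrisation datum `Dc` with `p ∤ c_{Dc}`; any `K`-model `VK` of `W_K`; and the LOWER half of `BSD_p` for `VK` over `K`
(«`#Ш_an(VK) = qK ∈ ℚ` with `ord_p qK ≤ ord_p #Ш(VK)[p^∞]`» — the OUTPUT CURRENCY of the card's θ-refined Eisenstein engine over `F`,
or of any base-change engine): `Typed.MissingLowerBoundAt W p`.  GIVEN `hDD`, `hKato`, `hGZK`, `hmod` (named facts, displayed).  This is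
`missingLowerBoundAt_of_lowerBaseChange_of_missingUpperBoundAt_twist` with its `hcUp` discharged by §1.
[cite: Kato2004Asterisque, Thm. 14.5 (3) (p. 236), Prop. 14.16 (2) (p. 244)] [cite: DokchitserDokchitserAnnals2010, §2.1 Thm. 2.3]
[cite: Miller2011LMS, Def. 1.1 (arXiv:1010.2431 p. 3)] -/
theorem missingLowerBoundAt_of_lowerBaseChange_of_kato_twist
    (hDD : Milne1972.bsdQuotientP_baseChange_relQuadratic_anyModel)
    (hKato : Kato2004.rankZero_padicValNat_sha_le_of_additive_potGood_of_imageContainsSL2)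
    (hGZK : rank_eq_analyticRank_of_analyticRank_le_one) (hmod : hasEntireLFunction_rat)
    (W : WeierstrassCurve ℚ) [W.IsElliptic] [W.IsGloballyMinimal] (hrW : W.analyticRank ≤ 1)
    (K : Type) [Field K] [NumberField K] (h2 : Module.finrank ℚ K = 2)
    {c : ℚ} {θ₁ : K} (hθ₁ : θ₁ ^ 2 = algebraMap ℚ K c) (hθK : θ₁ ∉ Set.range (algebraMap ℚ K))
    (Wc : WeierstrassCurve ℚ) [Wc.IsElliptic] [Wc.IsGloballyMinimal]
    (hWc : ∃ C : WeierstrassCurve.VariableChange ℚ, C • W.quadraticTwist c = Wc)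
    (VK : WeierstrassCurve K) [VK.IsElliptic]
    (hVK : ∃ C : WeierstrassCurve.VariableChange K, C • W.baseChange K = VK)
    (p : ℕ) [hp : Fact p.Prime] (hp5 : 5 ≤ p)
    -- the partner twist: additive potentially good at `p`, analytic rank `0`, `ρ̄` onto, Tamagawa, datum
    (haddc : Addv Wc p) (hpotc : 0 ≤ padicValRat p Wc.j) (hsurjc : Wc.HasSurjectiveModNGaloisRep p)
    (htamc : ¬ p ∣ Wc.tamagawaProduct) (hrc : Wc.analyticRank = 0)
    {Nc : ℕ} [NeZero Nc] (Dc : ModularParametrizationData Wc Nc) (hcc : ¬ (p : ℤ) ∣ Dc.maninConstant)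
    -- the LOWER half over the auxiliary field (engine output)
    (hKlow : ∃ qK : ℚ, analyticSha VK = (qK : ℂ) ∧
      padicValRat p qK ≤ padicValNat p (Nat.card (AddCommGroup.primaryComponent VK.sha p))) :
    MissingLowerBoundAt W p := by
  have hWfin : W.ShaFinite := (hGZK W hrW).2
  have hWcfin : Wc.ShaFinite := (hGZK Wc (by rw [hrc]; exact zero_le_one)).2
  have hcUp : MissingUpperBoundAt Wc p :=
    missingUpperBoundAt_of_kato_of_surj_of_five_le Wc p hKato hGZK hmod hp5 haddc hpotc hsurjc htamc hrc Dc hcc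
  exact missingLowerBoundAt_of_lowerBaseChange_of_missingUpperBoundAt_twist hDD W K h2 hθ₁ hθK Wc hWc VK hVK p hWfin hWcfin
    (hmod W) (hmod Wc) hKlow hcUp

/-! ## §3 The ♯-frame form: `p` unramified in the auxiliary field, the partner's binders discharged from the frame -/

/-- **The Eisenstein half of `BSD(E,p)` over `ℚ` at an additive potentially good `p ≥ 5` with `ρ̄_{E,p}` onto, from the LOWER half over a
quadratic field `K = ℚ(θ₁)`, `θ₁² = c`, in which `p` is UNRAMIFIED (`ord_p c = 0`; for the card `inert-theta-refinement`: `K = F` real with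
`p` inert), and Kato for the partner twist `E^{(c)}`.**  The partner's binders of §2 are DISCHARGED from the data on `E`: `ρ̄_{Wc,p}` onto
⟸ `ρ̄_{E,p}` onto (`Additive.surj_iff_of_model_twist`, Silverman X.5.4); `0 ≤ ord_p j(Wc) = ord_p j(E)` (`AdditivePotMult.j_of_model_twist`);
`Wc` additive at `p` ⟸ `E` additive at `p` and `ord_p c = 0` (`AddvUnitTwist.addv_of_model_unit_twist`, Silverman VII.5.1).  What is left as
hypotheses on the partner: `r_an(Wc) = 0` (a sign condition on `d_K`, Friedberg–Hoffstein-type supply), `p ∤ ∏ c_ℓ(Wc)`, a datum `Dc` with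
`p ∤ c_{Dc}`; and the LOWER half over `K` for a `K`-model `VK` of `E_K`.  Conclusion `Typed.MissingLowerBoundAt W p` — the hypothesis `hlow`
(for `W = E`, `r_an = 1`) resp. `hlowTw` (for `W` a minimal model of `E^{(d_K)}`, `r_an = 0`) of `AdditiveKoly.exists_kolyvaginClass_ne_zero_of_lowerHalves`.
[cite: Kato2004Asterisque, Thm. 14.5 (3) (p. 236), (12.5.2) (p. 222)] [cite: DokchitserDokchitserAnnals2010, §2.1 Thm. 2.3]
[cite: SilvermanAEC2009, VII.5 Prop. 5.1 and X.5 Cor. 5.4] [cite: Miller2011LMS, Def. 1.1 (arXiv:1010.2431 p. 3)] -/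
theorem missingLowerBoundAt_of_lowerBaseChange_unitTwist_of_kato
    (hDD : Milne1972.bsdQuotientP_baseChange_relQuadratic_anyModel)
    (hKato : Kato2004.rankZero_padicValNat_sha_le_of_additive_potGood_of_imageContainsSL2)
    (hGZK : rank_eq_analyticRank_of_analyticRank_le_one) (hmod : hasEntireLFunction_rat)
    (W : WeierstrassCurve ℚ) [W.IsElliptic] [W.IsGloballyMinimal] (p : ℕ) [hp : Fact p.Prime] (hp5 : 5 ≤ p)
    (hadd : Addv W p) (hpot : 0 ≤ padicValRat p W.j) (hsurj : W.HasSurjectiveModNGaloisRep p) (hrW : W.analyticRank ≤ 1)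
    (K : Type) [Field K] [NumberField K] (h2 : Module.finrank ℚ K = 2)
    {c : ℚ} {θ₁ : K} (hθ₁ : θ₁ ^ 2 = algebraMap ℚ K c) (hθK : θ₁ ∉ Set.range (algebraMap ℚ K))
    (hcu : padicValRat p c = 0)
    (Wc : WeierstrassCurve ℚ) [Wc.IsElliptic] [Wc.IsGloballyMinimal]
    (hWc : ∃ C : WeierstrassCurve.VariableChange ℚ, C • W.quadraticTwist c = Wc)
    (VK : WeierstrassCurve K) [VK.IsElliptic]
    (hVK : ∃ C : WeierstrassCurve.VariableChange K, C • W.baseChange K = VK)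
    -- what is left on the partner twist
    (hrc : Wc.analyticRank = 0) (htamc : ¬ p ∣ Wc.tamagawaProduct)
    {Nc : ℕ} [NeZero Nc] (Dc : ModularParametrizationData Wc Nc) (hcc : ¬ (p : ℤ) ∣ Dc.maninConstant)
    -- the LOWER half over the auxiliary field (engine output)
    (hKlow : ∃ qK : ℚ, analyticSha VK = (qK : ℂ) ∧
      padicValRat p qK ≤ padicValNat p (Nat.card (AddCommGroup.primaryComponent VK.sha p))) :
    MissingLowerBoundAt W p := by
  have hp2 : p ≠ 2 := by omega
  have hc0 : c ≠ 0 := by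
    rintro rfl
    rw [map_zero, pow_eq_zero_iff two_ne_zero] at hθ₁
    exact hθK ⟨0, by rw [map_zero, hθ₁]⟩
  -- the partner's binders, from `E`
  have hsurjc : Wc.HasSurjectiveModNGaloisRep p := (surj_iff_of_model_twist W p hc0 hWc).mpr hsurj
  have hpotc : 0 ≤ padicValRat p Wc.j := by rw [AdditivePotMult.j_of_model_twist (W := W) hc0 hWc]; exact hpot
  have haddc : Addv Wc p := AddvUnitTwist.addv_of_model_unit_twist hp2 hc0 hcu hadd hWc
  exact missingLowerBoundAt_of_lowerBaseChange_of_kato_twist hDD hKato hGZK hmod W hrW K h2 hθ₁ hθK Wc hWc VK hVK p hp5 haddc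
    hpotc hsurjc htamc hrc Dc hcc hKlow

end Summit.BirchSwinnertonDyer.BirchSwinnertonDyer.Theorems.AdditiveKoly.QuadraticDescent

end
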